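import Literature.Probability.RandomPlanarGeometry.SAWKestenRelation
import Mathlib.Topology.Algebra.InfiniteSum.NatInt
import Mathlib.Analysis.SpecialFunctions.Pow.Real
import Mathlib.Analysis.SumIntegralComparisons
import Mathlib.Analysis.SpecialFunctions.Integrals.Basic
import HarnessLib

/-!
# The truncated renewal identities for bridges and Kesten-tail ⇄ bridge-abundance conversions

Topic `Literature/Probability/RandomPlanarGeometry` (continues `SAWKestenRelation.lean`, `SAWBridgeRenewalLimit.lean`).

Source: N. Madras, G. Slade, *The Self-Avoiding Walk* (1993), §4.2 (p. 91; held text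
`book:madras1993-self-avoiding-walk` p0077:L3–36): the renewal structure of bridges, (4.2.2)
`b_n = Σ_{k ≤ n} λ_k b_{n−k}`, Kesten's relation (4.2.4) `Σ_k λ_k μ^{-k} = 1`, (4.2.5) `a_N = Σ p_k a_{N−k}`,
and "the Renewal Theorem implies that `lim b_N/μ^N` exists and equals `(Σ k p_k)^{-1}`" (L30) — a LIMIT only;
Appendix B (B.5) is the conservation law `Σ_{k ≤ n} r_k u_{n−k} = 1`. (1.2.17): `b_n ≤ μ^n`, bridges are
supermultiplicative. No quantitative tail ⇄ abundance statements are printed (M–S §4.3 treats only the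
subcritical, finite-mean renewal).

## What is new in this file (not in print)

Over `ℤ^d`, every `d ≥ 1`, with `R_j(x) = 1 − Σ_{k ≤ j} λ_k x^k` (`kestenTailPoly`), `M_j = Σ_{i ≤ j} R_i`:
* `bridge_renewal_identity` — `Σ_{n ≤ N} b_n xⁿ R_{N−n}(x) = 1` for EVERY real `x` (formal in `x`), and
  `bridge_renewal_identity_sum` — `Σ_{n ≤ N} b_n xⁿ M_{N−n}(x) = N + 1`;
* at `x = μ⁻¹` (`R_j = T_j = Σ_{k>j} λ_k μ^{-k}` by (4.2.4)): `bridgeSum_mul_tailSum_ge`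
  (`U_N · Σ_{j≤N} T_j ≥ N+1`) and `kestenTail_mul_bridgeSum_le_one` (`T_N · U_N ≤ 1`), `U_N = Σ_{n≤N} b_n μ^{-n}`;
* `bridgeSum_ge_of_kestenTail` — a Kesten tail RATE `T_j ≤ C j^{-δ}` (`0 < δ < 1`) gives the CESÀRO bridge
  abundance `U_N ≥ (N+1)/(1 + C N^{1−δ}/(1−δ))` (order `N^δ`, the sharp exponent);
* `exists_bridge_abundant_in_window` — a two-sided tail `c j^{-δ} ≤ T_j ≤ C j^{-δ}` gives, for every `N ≥ K`
  (`C ≤ (c/2)(K−1)^δ`), some `n ∈ (N/K, N]` with `b_n μ^{-n} ≥ 1/(2(1 + C N^{1−δ}/(1−δ)))`;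
* `bridge_abundant_all_of_window` — windowed abundance + supermultiplicativity ⇒ a quasi-polynomial ALL-`n`
  lower bound `b_N μ^{-N} ≥ μ^{-N₀} g(N)^j` for `N < N₀ (K/(K−1))^j`.
All conversions are unconditional implications; the tail rate itself (conjecturally `δ = 9/16` on `ℤ²`) is OPEN.
(Lane «pcv-sawmu» routes A5/R2; statements a-idea-1/a-p5, proofs a-p5.)
-/

noncomputable section

open Finset Filter Topology Literature.Probability.LatticeModels
open scoped BigOperators

namespace Literature.Probability.RandomPlanarGeometry.SAW.Zd

variable {d : ℕ} [NeZero d]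

/-- `R_j(x) = 1 - Σ_{k ≤ j} λ_k x^k` (the truncated complement of the irreducible-bridge series).
[cite: MadrasSlade1993, §4.2, eq. (4.2.4) (p. 91)] -/
def kestenTailPoly (d : ℕ) [NeZero d] (x : ℝ) (j : ℕ) : ℝ :=
  1 - ∑ k ∈ range (j + 1), (irreducibleBridgeCount d k : ℝ) * x ^ k

/-- `M_j(x) = Σ_{i ≤ j} R_i(x)` (truncated "mean").
[cite: MadrasSlade1993, §4.2 (p. 91); Appendix B, eq. (B.5)] -/
def kestenTailPolySum (d : ℕ) [NeZero d] (x : ℝ) (j : ℕ) : ℝ :=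
  ∑ i ∈ range (j + 1), kestenTailPoly d x i

/-- `R_0 = 1` (`λ₀ = 0`).
[cite: MadrasSlade1993, §4.2 (p. 91)] -/
theorem kestenTailPoly_zero (x : ℝ) : kestenTailPoly d x 0 = 1 := by
  rw [kestenTailPoly, zero_add, sum_range_one, irreducibleBridgeCount_zero, Nat.cast_zero, zero_mul, sub_zero]

/-- `R_{j+1} = R_j - λ_{j+1} x^{j+1}`.
[cite: MadrasSlade1993, §4.2 (p. 91)] -/
theorem kestenTailPoly_succ (x : ℝ) (j : ℕ) :
    kestenTailPoly d x (j + 1) = kestenTailPoly d x j - (irreducibleBridgeCount d (j + 1) : ℝ) * x ^ (j + 1) := by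
  rw [kestenTailPoly, kestenTailPoly, sum_range_succ]; ring

/-- The renewal equation, reflected: `Σ_{n ≤ N} λ_{N+1-n} b_n = b_{N+1}`.
[cite: MadrasSlade1993, §4.2, eq. (4.2.2) (p. 91)] -/
theorem sum_reflect_renewal (N : ℕ) :
    ∑ n ∈ range (N + 1), (irreducibleBridgeCount d (N + 1 - n) : ℝ) * bridgeCount d n =
      bridgeCount d (N + 1) := by
  have h := bridgeCount_eq_sum_range (d := d) (n := N + 1) (by omega)
  -- reflect `k ↦ N + 1 - k` in `b_{N+1} = Σ_{k ≤ N+1} λ_k b_{N+1-k}`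
  have hr : ∑ n ∈ range (N + 2), (irreducibleBridgeCount d (N + 1 - n) : ℝ) *
      bridgeCount d (N + 1 - (N + 1 - n)) =
      ∑ k ∈ range (N + 2), (irreducibleBridgeCount d k : ℝ) * bridgeCount d (N + 1 - k) := by
    rw [← sum_range_reflect (fun k => (irreducibleBridgeCount d k : ℝ) * bridgeCount d (N + 1 - k)) (N + 2)]
    exact sum_congr rfl fun j _ => by simp only [show N + 2 - 1 - j = N + 1 - j by omega]
  have hcast : (bridgeCount d (N + 1) : ℝ) =
      ∑ k ∈ range (N + 2), (irreducibleBridgeCount d k : ℝ) * bridgeCount d (N + 1 - k) := by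
    rw [h]; push_cast; rfl
  rw [hcast, ← hr]
  conv_rhs => rw [sum_range_succ, Nat.sub_self, irreducibleBridgeCount_zero, Nat.cast_zero, zero_mul,
    add_zero]
  exact sum_congr rfl fun n hn => by
    rw [mem_range] at hn
    rw [show N + 1 - (N + 1 - n) = n by omega]

/-- **Renewal identity, formal in `x`**: `Σ_{n ≤ N} b_n xⁿ R_{N-n}(x) = 1` for every real `x`.
[cite: MadrasSlade1993, §4.2, eq. (4.2.2) (p. 91); Appendix B, eq. (B.5)] -/
theorem bridge_renewal_identity (x : ℝ) (N : ℕ) :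
    ∑ n ∈ range (N + 1), (bridgeCount d n : ℝ) * x ^ n * kestenTailPoly d x (N - n) = 1 := by
  induction N with
  | zero =>
    simp only [zero_add, range_one, sum_singleton, Nat.sub_self, kestenTailPoly_zero, pow_zero, mul_one]
    have : bridgeCount d 0 = 1 :=
      le_antisymm ((bridgeCount_le_count 0).trans (count_zero d).le) (one_le_bridgeCount 0)
    exact_mod_cast this
  | succ N ih =>
    rw [sum_range_succ, Nat.sub_self, kestenTailPoly_zero, mul_one]
    have hstep : ∀ n ∈ range (N + 1), (bridgeCount d n : ℝ) * x ^ n * kestenTailPoly d x (N + 1 - n) =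
        (bridgeCount d n : ℝ) * x ^ n * kestenTailPoly d x (N - n) -
          x ^ (N + 1) * ((irreducibleBridgeCount d (N + 1 - n) : ℝ) * bridgeCount d n) := by
      intro n hn
      rw [mem_range] at hn
      rw [show N + 1 - n = (N - n) + 1 by omega, kestenTailPoly_succ]
      have : x ^ n * x ^ (N - n + 1) = x ^ (N + 1) := by rw [← pow_add]; congr 1; omega
      calc (bridgeCount d n : ℝ) * x ^ n *
            (kestenTailPoly d x (N - n) - (irreducibleBridgeCount d (N - n + 1) : ℝ) * x ^ (N - n + 1))
          = (bridgeCount d n : ℝ) * x ^ n * kestenTailPoly d x (N - n) -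
              (x ^ n * x ^ (N - n + 1)) * ((irreducibleBridgeCount d (N - n + 1) : ℝ) * bridgeCount d n) := by ring
        _ = _ := by rw [this]
    rw [sum_congr rfl hstep, sum_sub_distrib, ih, ← mul_sum, sum_reflect_renewal]
    ring

/-- `M_{j+1} = M_j + R_{j+1}`.
[cite: MadrasSlade1993, §4.2 (p. 91)] -/
theorem kestenTailPolySum_succ (x : ℝ) (j : ℕ) :
    kestenTailPolySum d x (j + 1) = kestenTailPolySum d x j + kestenTailPoly d x (j + 1) := by
  rw [kestenTailPolySum, kestenTailPolySum, sum_range_succ]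

/-- `M_0 = 1`.
[cite: MadrasSlade1993, §4.2 (p. 91)] -/
theorem kestenTailPolySum_zero (x : ℝ) : kestenTailPolySum d x 0 = 1 := by
  rw [kestenTailPolySum, zero_add, sum_range_one, kestenTailPoly_zero]

/-- **Summed renewal identity**: `Σ_{n ≤ N} b_n xⁿ M_{N-n}(x) = N + 1`.
[cite: MadrasSlade1993, §4.2, eq. (4.2.2) (p. 91); Appendix B, eq. (B.5)] -/
theorem bridge_renewal_identity_sum (x : ℝ) (N : ℕ) :
    ∑ n ∈ range (N + 1), (bridgeCount d n : ℝ) * x ^ n * kestenTailPolySum d x (N - n) = N + 1 := by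
  induction N with
  | zero =>
    simp only [zero_add, range_one, sum_singleton, Nat.sub_self, kestenTailPolySum_zero, pow_zero, mul_one,
      Nat.cast_zero]
    have : bridgeCount d 0 = 1 :=
      le_antisymm ((bridgeCount_le_count 0).trans (count_zero d).le) (one_le_bridgeCount 0)
    exact_mod_cast this
  | succ N ih =>
    have hid := bridge_renewal_identity (d := d) x (N + 1)
    rw [sum_range_succ, Nat.sub_self, kestenTailPoly_zero, mul_one] at hid
    rw [sum_range_succ, Nat.sub_self, kestenTailPolySum_zero, mul_one]
    have hstep : ∀ n ∈ range (N + 1), (bridgeCount d n : ℝ) * x ^ n * kestenTailPolySum d x (N + 1 - n) =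
        (bridgeCount d n : ℝ) * x ^ n * kestenTailPolySum d x (N - n) +
          (bridgeCount d n : ℝ) * x ^ n * kestenTailPoly d x (N + 1 - n) := by
      intro n hn
      rw [mem_range] at hn
      rw [show N + 1 - n = (N - n) + 1 by omega, kestenTailPolySum_succ]; ring
    rw [sum_congr rfl hstep, sum_add_distrib, ih]
    push_cast
    linarith

/-! ### At `x = μ⁻¹`: tails, and the Cesàro abundance from a tail rate -/

/-- At `x = μ⁻¹`, `R_j = T_j`, the KR tail: `1 - Σ_{k ≤ j} λ_k μ^{-k} = Σ_{k > j} λ_k μ^{-k}`.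
[cite: MadrasSlade1993, §4.2, eq. (4.2.4) (p. 91)] -/
theorem kestenTailPoly_inv_eq_tsum (j : ℕ) :
    kestenTailPoly d (connectiveConstant d)⁻¹ j =
      ∑' k : ℕ, (irreducibleBridgeCount d (k + (j + 1)) : ℝ) / connectiveConstant d ^ (k + (j + 1)) := by
  have hKR := MadrasSlade1993_eq424_holds d
  have hsplit := hKR.summable.sum_add_tsum_nat_add (j + 1)
  rw [hKR.tsum_eq] at hsplit
  rw [kestenTailPoly]
  have : ∑ k ∈ range (j + 1), (irreducibleBridgeCount d k : ℝ) * (connectiveConstant d)⁻¹ ^ k =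
      ∑ k ∈ range (j + 1), (irreducibleBridgeCount d k : ℝ) / connectiveConstant d ^ k :=
    sum_congr rfl fun k _ => by rw [inv_pow, div_eq_mul_inv]
  rw [this]
  linarith

/-- The tails are nonnegative.
[cite: MadrasSlade1993, §4.2, eq. (4.2.4) (p. 91)] -/
theorem kestenTailPoly_inv_nonneg (j : ℕ) : 0 ≤ kestenTailPoly d (connectiveConstant d)⁻¹ j := by
  rw [kestenTailPoly_inv_eq_tsum]
  exact tsum_nonneg fun k => div_nonneg (Nat.cast_nonneg _) (pow_nonneg (connectiveConstant_pos d).le _)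

/-- The truncated means are monotone at `x = μ⁻¹`.
[cite: MadrasSlade1993, §4.2 (p. 91)] -/
theorem kestenTailPolySum_inv_mono {i j : ℕ} (h : i ≤ j) :
    kestenTailPolySum d (connectiveConstant d)⁻¹ i ≤ kestenTailPolySum d (connectiveConstant d)⁻¹ j :=
  sum_le_sum_of_subset_of_nonneg (range_subset_range.2 (by omega)) fun k _ _ => kestenTailPoly_inv_nonneg k

/-- **`U_N · M_N ≥ N + 1`** at `x = μ⁻¹`: `(Σ_{n ≤ N} b_n μ^{-n}) · (Σ_{j ≤ N} T_j) ≥ N + 1`.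
[cite: MadrasSlade1993, §4.2 (p. 91); Appendix B, eq. (B.5)] -/
theorem bridgeSum_mul_tailSum_ge (N : ℕ) :
    (N : ℝ) + 1 ≤ (∑ n ∈ range (N + 1), (bridgeCount d n : ℝ) / connectiveConstant d ^ n) *
      kestenTailPolySum d (connectiveConstant d)⁻¹ N := by
  have hμ : 0 < connectiveConstant d := connectiveConstant_pos d
  have hid := bridge_renewal_identity_sum (d := d) (connectiveConstant d)⁻¹ N
  rw [← hid, sum_mul]
  refine sum_le_sum fun n hn => ?_
  rw [mem_range] at hn
  rw [inv_pow, ← div_eq_mul_inv]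
  exact mul_le_mul_of_nonneg_left (kestenTailPolySum_inv_mono (by omega))
    (div_nonneg (Nat.cast_nonneg _) (pow_nonneg hμ.le _))

/-- Integral comparison: `Σ_{j=1}^{N} j^{-δ} ≤ N^{1-δ}/(1-δ)` for `0 < δ < 1`, `N ≥ 1`. [folklore] -/
private theorem sum_rpow_neg_le {δ : ℝ} (hδ0 : 0 < δ) (hδ1 : δ < 1) {N : ℕ} (hN : 1 ≤ N) :
    ∑ j ∈ Icc 1 N, (j : ℝ) ^ (-δ) ≤ (N : ℝ) ^ (1 - δ) / (1 - δ) := by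
  have h1δ : 0 < 1 - δ := by linarith
  -- split off `j = 1` and compare the rest with `∫_1^N t^{-δ} dt`
  have hanti : AntitoneOn (fun t : ℝ => t ^ (-δ)) (Set.Icc (1 : ℝ) (1 + ((N - 1 : ℕ) : ℝ))) := by
    intro a ha b hb hab
    exact Real.rpow_le_rpow_of_nonpos (by linarith [ha.1]) hab (by linarith)
  have hcmp := AntitoneOn.sum_le_integral hanti
  -- `Σ_{i < N-1} (1 + (i+1))^{-δ} = Σ_{j=2}^{N} j^{-δ}`
  have hint : ∫ t in (1 : ℝ)..1 + ((N - 1 : ℕ) : ℝ), t ^ (-δ) = ((N : ℝ) ^ (1 - δ) - 1) / (1 - δ) := by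
    have hN1 : (1 : ℝ) + ((N - 1 : ℕ) : ℝ) = N := by
      rw [Nat.cast_sub hN]; push_cast; ring
    rw [hN1, integral_rpow (Or.inr ⟨by linarith, ?_⟩)]
    · rw [show -δ + 1 = 1 - δ by ring, Real.one_rpow]
    · rw [Set.uIcc_of_le (by exact_mod_cast hN)]
      exact fun h => by linarith [h.1]
  have hsplit : ∑ j ∈ Icc 1 N, (j : ℝ) ^ (-δ) = 1 + ∑ i ∈ range (N - 1), ((1 : ℝ) + ((i + 1 : ℕ) : ℝ)) ^ (-δ) := by
    rw [show Icc 1 N = insert 1 (Icc 2 N) by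
      ext j; simp only [mem_insert, mem_Icc]; omega, sum_insert (by simp), Nat.cast_one, Real.one_rpow]
    congr 1
    rw [show Icc 2 N = (range (N - 1)).image (fun i => i + 2) by
      ext j; simp only [mem_Icc, mem_image, mem_range]; constructor
      · intro h; exact ⟨j - 2, by omega, by omega⟩
      · rintro ⟨i, hi, rfl⟩; omega, sum_image fun a _ b _ h => by omega]
    refine sum_congr rfl fun i _ => ?_
    push_cast; ring_nf
  rw [hsplit]
  rw [hint] at hcmp
  have hlast : (1 : ℝ) + ((N : ℝ) ^ (1 - δ) - 1) / (1 - δ) ≤ (N : ℝ) ^ (1 - δ) / (1 - δ) := by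
    rw [show (1 : ℝ) + ((N : ℝ) ^ (1 - δ) - 1) / (1 - δ) = ((N : ℝ) ^ (1 - δ) - δ) / (1 - δ) by
      field_simp; ring]
    exact div_le_div_of_nonneg_right (by linarith) h1δ.le
  linarith

/-- The truncated mean under a tail rate: `Σ_{j ≤ N} T_j ≤ 1 + C N^{1-δ}/(1-δ)`.
[cite: MadrasSlade1993, §4.2 (p. 91)] -/
theorem kestenTailPolySum_le_of_kestenTail {C δ : ℝ} (hδ0 : 0 < δ) (hδ1 : δ < 1)
    (hT : ∀ j : ℕ, 1 ≤ j → ∑' k : ℕ, (irreducibleBridgeCount d (k + (j + 1)) : ℝ) /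
        connectiveConstant d ^ (k + (j + 1)) ≤ C * (j : ℝ) ^ (-δ))
    {N : ℕ} (hN : 1 ≤ N) :
    kestenTailPolySum d (connectiveConstant d)⁻¹ N ≤ 1 + C * ((N : ℝ) ^ (1 - δ) / (1 - δ)) := by
  have h1δ : 0 < 1 - δ := by linarith
  rw [kestenTailPolySum, range_eq_Ico, ← sum_Ico_consecutive _ (Nat.zero_le 1) (show 1 ≤ N + 1 by omega)]
  have hI0 : ∑ i ∈ Ico 0 1, kestenTailPoly d (connectiveConstant d)⁻¹ i = 1 := by
    rw [show Ico 0 1 = {0} by rfl, sum_singleton, kestenTailPoly_zero]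
  have hIcc : Ico 1 (N + 1) = Icc 1 N := by ext j; simp only [mem_Ico, mem_Icc]; omega
  rw [hI0, hIcc]
  have hle : ∑ j ∈ Icc 1 N, kestenTailPoly d (connectiveConstant d)⁻¹ j ≤ ∑ j ∈ Icc 1 N, C * (j : ℝ) ^ (-δ) :=
    sum_le_sum fun j hj => by
      rw [mem_Icc] at hj
      rw [kestenTailPoly_inv_eq_tsum]; exact hT j hj.1
  have hC : 0 ≤ C := by
    have h := hT 1 le_rfl
    have h0 : 0 ≤ ∑' k : ℕ, (irreducibleBridgeCount d (k + (1 + 1)) : ℝ) / connectiveConstant d ^ (k + (1 + 1)) :=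
      tsum_nonneg fun k => div_nonneg (Nat.cast_nonneg _) (pow_nonneg (connectiveConstant_pos d).le _)
    simp only [Nat.cast_one, Real.one_rpow, mul_one] at h
    linarith
  calc 1 + ∑ j ∈ Icc 1 N, kestenTailPoly d (connectiveConstant d)⁻¹ j
      ≤ 1 + ∑ j ∈ Icc 1 N, C * (j : ℝ) ^ (-δ) := by linarith
    _ = 1 + C * ∑ j ∈ Icc 1 N, (j : ℝ) ^ (-δ) := by rw [mul_sum]
    _ ≤ 1 + C * ((N : ℝ) ^ (1 - δ) / (1 - δ)) := by
        gcongr; exact sum_rpow_neg_le hδ0 hδ1 hN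

/-- **A Kesten tail rate gives Cesàro bridge abundance with exponent `δ`**: a Kesten tail rate
`Σ_{k>j} λ_k μ^{-k} ≤ C j^{-δ}` (`j ≥ 1`, `0 < δ < 1`) gives, for every `N ≥ 1`,
`Σ_{n ≤ N} b_n μ^{-n} ≥ (N + 1) / (1 + C N^{1-δ}/(1-δ))` (order `N^δ`). On `ℤ^d`, every `d ≥ 1`.
[cite: MadrasSlade1993, §4.2 (p. 91); Theorem 4.2.2 (b)] -/
theorem bridgeSum_ge_of_kestenTail {C δ : ℝ} (hδ0 : 0 < δ) (hδ1 : δ < 1)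
    (hT : ∀ j : ℕ, 1 ≤ j → ∑' k : ℕ, (irreducibleBridgeCount d (k + (j + 1)) : ℝ) /
        connectiveConstant d ^ (k + (j + 1)) ≤ C * (j : ℝ) ^ (-δ))
    {N : ℕ} (hN : 1 ≤ N) :
    ((N : ℝ) + 1) / (1 + C * ((N : ℝ) ^ (1 - δ) / (1 - δ))) ≤
      ∑ n ∈ range (N + 1), (bridgeCount d n : ℝ) / connectiveConstant d ^ n := by
  have hμ : 0 < connectiveConstant d := connectiveConstant_pos d
  set U := ∑ n ∈ range (N + 1), (bridgeCount d n : ℝ) / connectiveConstant d ^ n with hU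
  set M := kestenTailPolySum d (connectiveConstant d)⁻¹ N with hM
  have h1 : (N : ℝ) + 1 ≤ U * M := bridgeSum_mul_tailSum_ge N
  have h2 : M ≤ 1 + C * ((N : ℝ) ^ (1 - δ) / (1 - δ)) := kestenTailPolySum_le_of_kestenTail hδ0 hδ1 hT hN
  have hU0 : 0 ≤ U := sum_nonneg fun n _ => div_nonneg (Nat.cast_nonneg _) (pow_nonneg hμ.le _)
  have hM1 : 1 ≤ M := by
    rw [hM, kestenTailPolySum, sum_range_succ', kestenTailPoly_zero]
    linarith [sum_nonneg fun (i : ℕ) (_ : i ∈ range N) => kestenTailPoly_inv_nonneg (d := d) (i + 1)]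
  have hB : 0 < 1 + C * ((N : ℝ) ^ (1 - δ) / (1 - δ)) := by linarith
  rw [div_le_iff₀ hB]
  calc (N : ℝ) + 1 ≤ U * M := h1
    _ ≤ U * (1 + C * ((N : ℝ) ^ (1 - δ) / (1 - δ))) := mul_le_mul_of_nonneg_left h2 hU0

/-! ## R2.3: two-sided Kesten tail ⇒ WINDOWED pointwise bridge abundance

From the renewal identity `Σ_{n ≤ N} u_n T_{N-n} = 1` (`u_n = b_n μ^{-n}`, `T_j` the KR tails):
the terms `n ≤ N/K` contribute at most `U_{⌊N/K⌋} · T_{N-⌊N/K⌋} ≤ (C/c)·(⌊N/K⌋/(N-⌊N/K⌋))^δ`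
(tail–bridge inequality + the LOWER tail bound), which is `≤ 1/2` once `(C/c)(K-1)^{-δ} ≤ 1/2`;
the remaining window `(N/K, N]` then carries mass `≥ 1/2`, and since `Σ_j T_j ≤ 1 + C N^{1-δ}/(1-δ)`
some `n` in the window has `u_n ≥ 1/(2(1 + C N^{1-δ}/(1-δ)))`, i.e. `b_n ≳ N^{-(1-δ)} μ^n`. -/

/-- The KR tails are antitone.
[cite: MadrasSlade1993, §4.2, eq. (4.2.4) (p. 91)] -/
theorem kestenTailPoly_inv_antitone {i j : ℕ} (h : i ≤ j) :
    kestenTailPoly d (connectiveConstant d)⁻¹ j ≤ kestenTailPoly d (connectiveConstant d)⁻¹ i := by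
  induction h with
  | refl => exact le_rfl
  | step _ ih =>
    refine le_trans ?_ ih
    rw [kestenTailPoly_succ, sub_le_self_iff]
    exact mul_nonneg (Nat.cast_nonneg _) (pow_nonneg (inv_nonneg.2 (connectiveConstant_pos d).le) _)

/-- Tail–bridge inequality in the `kestenTailPoly` vocabulary: `T_m · U_m ≤ 1`.
[cite: MadrasSlade1993, §4.2 (p. 91); Appendix B, eq. (B.5)] -/
theorem kestenTail_mul_bridgeSum_le_one (m : ℕ) :
    kestenTailPoly d (connectiveConstant d)⁻¹ m *
      ∑ n ∈ range (m + 1), (bridgeCount d n : ℝ) / connectiveConstant d ^ n ≤ 1 := by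
  have hμ : 0 < connectiveConstant d := connectiveConstant_pos d
  have hid := bridge_renewal_identity (d := d) (connectiveConstant d)⁻¹ m
  rw [mul_sum, ← hid]
  refine sum_le_sum fun n hn => ?_
  rw [mem_range] at hn
  rw [inv_pow, ← div_eq_mul_inv, mul_comm]
  exact mul_le_mul_of_nonneg_left (kestenTailPoly_inv_antitone (by omega))
    (div_nonneg (Nat.cast_nonneg _) (pow_nonneg hμ.le _))

/-- **Windowed pointwise bridge abundance from a two-sided Kesten tail.** Let `0 < δ < 1`,
`0 < c`, and suppose `c j^{-δ} ≤ T_j ≤ C j^{-δ}` for all `j ≥ 1`. If `K ≥ 2` satisfies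
`C ≤ (c/2)·(K-1)^δ` then for every `N ≥ K` there is `n` with `⌊N/K⌋ < n ≤ N` and
`b_n μ^{-n} ≥ 1 / (2(1 + C N^{1-δ}/(1-δ)))` (order `N^{-(1-δ)}`). On `ℤ^d`, every `d ≥ 1`.
[cite: MadrasSlade1993, §4.2 (p. 91); eq. (1.2.17)] -/
theorem exists_bridge_abundant_in_window {C c δ : ℝ} (hδ0 : 0 < δ) (hδ1 : δ < 1) (hc : 0 < c)
    (hT : ∀ j : ℕ, 1 ≤ j → ∑' k : ℕ, (irreducibleBridgeCount d (k + (j + 1)) : ℝ) /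
        connectiveConstant d ^ (k + (j + 1)) ≤ C * (j : ℝ) ^ (-δ))
    (hTlow : ∀ j : ℕ, 1 ≤ j → c * (j : ℝ) ^ (-δ) ≤ ∑' k : ℕ, (irreducibleBridgeCount d (k + (j + 1)) : ℝ) /
        connectiveConstant d ^ (k + (j + 1)))
    {K : ℕ} (hK : 2 ≤ K) (hKC : C ≤ c / 2 * ((K : ℝ) - 1) ^ δ) {N : ℕ} (hN : K ≤ N) :
    ∃ n : ℕ, N / K < n ∧ n ≤ N ∧
      1 / (2 * (1 + C * ((N : ℝ) ^ (1 - δ) / (1 - δ)))) ≤ (bridgeCount d n : ℝ) / connectiveConstant d ^ n := by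
  have hμ : 0 < connectiveConstant d := connectiveConstant_pos d
  have hu0 : ∀ n, 0 ≤ (bridgeCount d n : ℝ) / connectiveConstant d ^ n :=
    fun n => div_nonneg (Nat.cast_nonneg _) (pow_nonneg hμ.le _)
  have hT0 : ∀ j, 0 ≤ kestenTailPoly d (connectiveConstant d)⁻¹ j := fun j => kestenTailPoly_inv_nonneg j
  have hC0 : 0 ≤ C := by
    have := le_trans (hTlow 1 le_rfl) (hT 1 le_rfl)
    simp only [Nat.cast_one, Real.one_rpow, mul_one] at this
    linarith
  set n1 := N / K with hn1
  have hK0 : 0 < K := by omega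
  have hn1N : n1 < N := Nat.div_lt_self (by omega) (by omega)
  have hn1pos : 1 ≤ n1 := (Nat.le_div_iff_mul_le hK0).2 (by simpa using hN)
  have hmul : n1 * K ≤ N := by rw [hn1]; exact Nat.div_mul_le_self N K
  have hNn1 : (K - 1) * n1 ≤ N - n1 := by
    rw [Nat.sub_mul, one_mul, mul_comm]
    exact Nat.sub_le_sub_right hmul n1
  -- the identity at `x = μ⁻¹`, split at `n1`
  have hid := bridge_renewal_identity (d := d) (connectiveConstant d)⁻¹ N
  have hterm : ∀ n ∈ range (N + 1), (bridgeCount d n : ℝ) * (connectiveConstant d)⁻¹ ^ n *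
      kestenTailPoly d (connectiveConstant d)⁻¹ (N - n) =
      (bridgeCount d n : ℝ) / connectiveConstant d ^ n * kestenTailPoly d (connectiveConstant d)⁻¹ (N - n) :=
    fun n _ => by rw [inv_pow, div_eq_mul_inv]
  rw [sum_congr rfl hterm, range_eq_Ico,
    ← sum_Ico_consecutive _ (Nat.zero_le _) (show n1 + 1 ≤ N + 1 by omega), ← range_eq_Ico] at hid
  -- first block `≤ 1/2`
  have hblock1 : ∑ n ∈ range (n1 + 1), (bridgeCount d n : ℝ) / connectiveConstant d ^ n *
      kestenTailPoly d (connectiveConstant d)⁻¹ (N - n) ≤ 1 / 2 := by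
    have h1 : ∑ n ∈ range (n1 + 1), (bridgeCount d n : ℝ) / connectiveConstant d ^ n *
        kestenTailPoly d (connectiveConstant d)⁻¹ (N - n) ≤
        (∑ n ∈ range (n1 + 1), (bridgeCount d n : ℝ) / connectiveConstant d ^ n) *
          kestenTailPoly d (connectiveConstant d)⁻¹ (N - n1) := by
      rw [sum_mul]
      refine sum_le_sum fun n hn => ?_
      rw [mem_range] at hn
      exact mul_le_mul_of_nonneg_left (kestenTailPoly_inv_antitone (by omega)) (hu0 n)
    have hTn1 : c * (n1 : ℝ) ^ (-δ) ≤ kestenTailPoly d (connectiveConstant d)⁻¹ n1 := by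
      rw [kestenTailPoly_inv_eq_tsum]; exact hTlow n1 hn1pos
    have hTNn1 : kestenTailPoly d (connectiveConstant d)⁻¹ (N - n1) ≤ C * ((N - n1 : ℕ) : ℝ) ^ (-δ) := by
      rw [kestenTailPoly_inv_eq_tsum]; exact hT (N - n1) (by omega)
    have hn1r : (0 : ℝ) < n1 := by exact_mod_cast hn1pos
    have hpow1 : 0 < (n1 : ℝ) ^ (-δ) := Real.rpow_pos_of_pos hn1r _
    have hU : ∑ n ∈ range (n1 + 1), (bridgeCount d n : ℝ) / connectiveConstant d ^ n ≤
        1 / (c * (n1 : ℝ) ^ (-δ)) := by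
      rw [le_div_iff₀ (mul_pos hc hpow1)]
      calc (∑ n ∈ range (n1 + 1), (bridgeCount d n : ℝ) / connectiveConstant d ^ n) * (c * (n1 : ℝ) ^ (-δ))
          ≤ (∑ n ∈ range (n1 + 1), (bridgeCount d n : ℝ) / connectiveConstant d ^ n) *
              kestenTailPoly d (connectiveConstant d)⁻¹ n1 :=
            mul_le_mul_of_nonneg_left hTn1 (sum_nonneg fun n _ => hu0 n)
        _ ≤ 1 := by rw [mul_comm]; exact kestenTail_mul_bridgeSum_le_one n1
    have hKr : (1 : ℝ) ≤ (K : ℝ) - 1 := by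
      have : (2 : ℝ) ≤ K := by exact_mod_cast hK
      linarith
    have hNn1r : ((K : ℝ) - 1) * n1 ≤ ((N - n1 : ℕ) : ℝ) := by
      have h2 : (((K - 1) * n1 : ℕ) : ℝ) ≤ ((N - n1 : ℕ) : ℝ) := by exact_mod_cast hNn1
      rw [Nat.cast_mul, Nat.cast_sub (by omega), Nat.cast_one] at h2
      exact h2
    have hpow2 : ((N - n1 : ℕ) : ℝ) ^ (-δ) ≤ (((K : ℝ) - 1) * n1) ^ (-δ) :=
      Real.rpow_le_rpow_of_nonpos (by positivity) hNn1r (by linarith)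
    have hpow3 : (((K : ℝ) - 1) * n1) ^ (-δ) = ((K : ℝ) - 1) ^ (-δ) * (n1 : ℝ) ^ (-δ) :=
      Real.mul_rpow (by linarith) hn1r.le
    have hKpow : 0 < ((K : ℝ) - 1) ^ δ := Real.rpow_pos_of_pos (by linarith) _
    calc ∑ n ∈ range (n1 + 1), (bridgeCount d n : ℝ) / connectiveConstant d ^ n *
          kestenTailPoly d (connectiveConstant d)⁻¹ (N - n)
        ≤ (∑ n ∈ range (n1 + 1), (bridgeCount d n : ℝ) / connectiveConstant d ^ n) *
            kestenTailPoly d (connectiveConstant d)⁻¹ (N - n1) := h1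
      _ ≤ (1 / (c * (n1 : ℝ) ^ (-δ))) * (C * (((K : ℝ) - 1) ^ (-δ) * (n1 : ℝ) ^ (-δ))) := by
          refine mul_le_mul hU (le_trans hTNn1 ?_) (hT0 _) (by positivity)
          rw [← hpow3]; exact mul_le_mul_of_nonneg_left hpow2 hC0
      _ = (C / c) * ((K : ℝ) - 1) ^ (-δ) := by field_simp
      _ ≤ 1 / 2 := by
          rw [Real.rpow_neg (by linarith), div_mul_eq_mul_div, div_le_iff₀ hc, ← div_eq_mul_inv,
            div_le_iff₀ hKpow]
          linarith
  -- the window block carries mass ≥ 1/2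
  have hblock2 : 1 / 2 ≤ ∑ n ∈ Ico (n1 + 1) (N + 1), (bridgeCount d n : ℝ) / connectiveConstant d ^ n *
      kestenTailPoly d (connectiveConstant d)⁻¹ (N - n) := by linarith
  have hM := kestenTailPolySum_le_of_kestenTail (d := d) hδ0 hδ1 hT (show 1 ≤ N by omega)
  have hMpos : 0 < 1 + C * ((N : ℝ) ^ (1 - δ) / (1 - δ)) := by
    have : 0 ≤ C * ((N : ℝ) ^ (1 - δ) / (1 - δ)) := by
      apply mul_nonneg hC0; apply div_nonneg (Real.rpow_nonneg (Nat.cast_nonneg _) _); linarith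
    linarith
  by_contra hnone
  push Not at hnone
  have hlt : ∑ n ∈ Ico (n1 + 1) (N + 1), (bridgeCount d n : ℝ) / connectiveConstant d ^ n *
      kestenTailPoly d (connectiveConstant d)⁻¹ (N - n) <
      ∑ n ∈ Ico (n1 + 1) (N + 1), (1 / (2 * (1 + C * ((N : ℝ) ^ (1 - δ) / (1 - δ))))) *
        kestenTailPoly d (connectiveConstant d)⁻¹ (N - n) := by
    apply sum_lt_sum
    · intro n hn
      rw [mem_Ico] at hn
      exact mul_le_mul_of_nonneg_right (hnone n (by omega) (by omega)).le (hT0 _)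
    · refine ⟨N, by rw [mem_Ico]; omega, ?_⟩
      rw [Nat.sub_self, kestenTailPoly_zero, mul_one, mul_one]
      exact hnone N (by omega) le_rfl
  have hTsum : ∑ n ∈ Ico (n1 + 1) (N + 1), kestenTailPoly d (connectiveConstant d)⁻¹ (N - n) ≤
      kestenTailPolySum d (connectiveConstant d)⁻¹ N := by
    rw [kestenTailPolySum]
    have hre : ∑ n ∈ Ico (n1 + 1) (N + 1), kestenTailPoly d (connectiveConstant d)⁻¹ (N - n) =
        ∑ j ∈ range (N - n1), kestenTailPoly d (connectiveConstant d)⁻¹ j := by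
      rw [sum_Ico_eq_sum_range, show N + 1 - (n1 + 1) = N - n1 by omega,
        ← sum_range_reflect (fun j => kestenTailPoly d (connectiveConstant d)⁻¹ j) (N - n1)]
      refine sum_congr rfl fun j hj => ?_
      rw [mem_range] at hj
      congr 1; omega
    rw [hre]
    exact sum_le_sum_of_subset_of_nonneg (range_subset_range.2 (by omega)) fun j _ _ => hT0 j
  have hle : ∑ n ∈ Ico (n1 + 1) (N + 1), (1 / (2 * (1 + C * ((N : ℝ) ^ (1 - δ) / (1 - δ))))) *
      kestenTailPoly d (connectiveConstant d)⁻¹ (N - n) ≤ 1 / 2 := by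
    rw [← mul_sum]
    calc 1 / (2 * (1 + C * ((N : ℝ) ^ (1 - δ) / (1 - δ)))) *
          ∑ n ∈ Ico (n1 + 1) (N + 1), kestenTailPoly d (connectiveConstant d)⁻¹ (N - n)
        ≤ 1 / (2 * (1 + C * ((N : ℝ) ^ (1 - δ) / (1 - δ)))) * (1 + C * ((N : ℝ) ^ (1 - δ) / (1 - δ))) :=
          mul_le_mul_of_nonneg_left (le_trans hTsum hM) (by positivity)
      _ = 1 / 2 := by
          rw [div_mul_eq_mul_div, one_mul, div_eq_iff (mul_ne_zero two_ne_zero hMpos.ne')]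
          ring
  linarith

/-! ## R2.4: windowed abundance + supermultiplicativity ⇒ quasi-polynomial abundance at ALL lengths

Abstract chaining: if `u_n = b_n μ^{-n}` (supermultiplicative, `b_m b_n ≤ b_{m+n}`) has, for every
`N ≥ N₀`, a "good" length `n ∈ (N/K, N]` with `u_n ≥ g(N)` (`g` antitone, nonnegative), then peeling
good lengths `j` times covers every `N < N₀ (K/(K-1))^j`: `u_N ≥ μ^{-N₀} g(N)^j`. With
`j ≈ log(N/N₀)/log(K/(K-1))` and `g(N) ≍ N^{-(1-δ)}` (R2.3) this is `b_N ≥ μ^N e^{-O(log² N)}`. -/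

/-- Supermultiplicativity at `z_c`: `u_{m+n} ≥ u_m u_n`.
[cite: MadrasSlade1993, §1.2, eq. (1.2.17)] -/
theorem bridgeRatio_supermul (m n : ℕ) :
    (bridgeCount d m : ℝ) / connectiveConstant d ^ m * ((bridgeCount d n : ℝ) / connectiveConstant d ^ n) ≤
      (bridgeCount d (m + n) : ℝ) / connectiveConstant d ^ (m + n) := by
  have hμ : 0 < connectiveConstant d := connectiveConstant_pos d
  rw [div_mul_div_comm, ← pow_add]
  exact div_le_div_of_nonneg_right (by exact_mod_cast bridgeCount_mul_le m n) (pow_nonneg hμ.le _)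

/-- Every length has `u_n ≥ μ^{-n}` (`b_n ≥ 1`).
[cite: MadrasSlade1993, §1.2, eq. (1.2.17)] -/
theorem bridgeRatio_ge_inv_pow (n : ℕ) :
    (connectiveConstant d ^ n)⁻¹ ≤ (bridgeCount d n : ℝ) / connectiveConstant d ^ n := by
  have hμ : 0 < connectiveConstant d := connectiveConstant_pos d
  rw [inv_eq_one_div]
  exact div_le_div_of_nonneg_right (by exact_mod_cast one_le_bridgeCount n) (pow_nonneg hμ.le _)

/-- **Chaining windowed abundance through supermultiplicativity.** Suppose that for every
`N ≥ N₀` there is `n ≤ N` with `N < K·n` and `b_n μ^{-n} ≥ g(N)`, where `0 ≤ g ≤ 1` is antitone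
and `K ≥ 2`. Then for all `j` and all `N < N₀ · (K/(K-1))^j`: `b_N μ^{-N} ≥ μ^{-N₀} · g(N)^j`
(take `j = ⌈log(N/N₀)/log(K/(K-1))⌉ + 1`: a quasi-polynomial lower bound when `g(N) ≍ N^{-(1-δ)}`).
[cite: MadrasSlade1993, §1.2, eq. (1.2.17); §4.2 (p. 91)] -/
theorem bridge_abundant_all_of_window {N₀ K : ℕ} (hK : 2 ≤ K) {g : ℕ → ℝ} (hg0 : ∀ N, 0 ≤ g N)
    (hg1 : ∀ N, g N ≤ 1) (hga : Antitone g)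
    (hwin : ∀ N : ℕ, N₀ ≤ N → ∃ n : ℕ, n ≤ N ∧ N < K * n ∧
      g N ≤ (bridgeCount d n : ℝ) / connectiveConstant d ^ n)
    (j N : ℕ) (hN : (N : ℝ) < N₀ * ((K : ℝ) / ((K : ℝ) - 1)) ^ j) :
    (connectiveConstant d ^ N₀)⁻¹ * g N ^ j ≤ (bridgeCount d N : ℝ) / connectiveConstant d ^ N := by
  have hμ : 0 < connectiveConstant d := connectiveConstant_pos d
  have hμ1 : 1 ≤ connectiveConstant d := one_le_connectiveConstant d
  have hK2 : (2 : ℝ) ≤ K := by exact_mod_cast hK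
  have hK1 : (0 : ℝ) < (K : ℝ) - 1 := by linarith
  have hKpos : (0 : ℝ) < K := by linarith
  -- small lengths: the trivial bound `u_N ≥ μ^{-N} ≥ μ^{-N₀} ≥ μ^{-N₀} g(N)^j`
  have small : ∀ (j N : ℕ), N < N₀ →
      (connectiveConstant d ^ N₀)⁻¹ * g N ^ j ≤ (bridgeCount d N : ℝ) / connectiveConstant d ^ N := by
    intro j N hNN
    refine le_trans ?_ (bridgeRatio_ge_inv_pow N)
    calc (connectiveConstant d ^ N₀)⁻¹ * g N ^ j ≤ (connectiveConstant d ^ N₀)⁻¹ * 1 :=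
          mul_le_mul_of_nonneg_left (pow_le_one₀ (hg0 N) (hg1 N)) (inv_nonneg.2 (pow_nonneg hμ.le _))
      _ ≤ (connectiveConstant d ^ N)⁻¹ := by
          rw [mul_one]; exact inv_anti₀ (pow_pos hμ _) (pow_le_pow_right₀ hμ1 hNN.le)
  induction j generalizing N with
  | zero =>
    rw [pow_zero, mul_one] at hN
    exact small 0 N (by exact_mod_cast hN)
  | succ j ih =>
    by_cases hsmall : N < N₀
    · exact small _ N hsmall
    · push Not at hsmall
      obtain ⟨n, hnN, hKn, hgn⟩ := hwin N hsmall
      -- the remainder `N - n` satisfies `N - n < N₀ r^j`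
      have hrem : ((N - n : ℕ) : ℝ) < N₀ * ((K : ℝ) / ((K : ℝ) - 1)) ^ j := by
        have hKn' : (N : ℝ) < K * n := by exact_mod_cast hKn
        have h2 : ((N - n : ℕ) : ℝ) = (N : ℝ) - n := by rw [Nat.cast_sub hnN]
        rw [h2]
        -- `K (N - n) < (K-1) N < (K-1) N₀ r^{j+1} = K N₀ r^j`
        have h3 : (K : ℝ) * ((N : ℝ) - n) < ((K : ℝ) - 1) * (N₀ * ((K : ℝ) / ((K : ℝ) - 1)) ^ (j + 1)) := by
          have h0 : (0 : ℝ) ≤ N := Nat.cast_nonneg _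
          nlinarith
        have h4 : ((K : ℝ) - 1) * (N₀ * ((K : ℝ) / ((K : ℝ) - 1)) ^ (j + 1)) =
            K * (N₀ * ((K : ℝ) / ((K : ℝ) - 1)) ^ j) := by
          rw [pow_succ]; field_simp
        rw [h4] at h3
        exact lt_of_mul_lt_mul_left h3 hKpos.le
      have hih := ih (N - n) hrem
      have hgmono : g N ≤ g (N - n) := hga (Nat.sub_le N n)
      calc (connectiveConstant d ^ N₀)⁻¹ * g N ^ (j + 1)
          = g N * ((connectiveConstant d ^ N₀)⁻¹ * g N ^ j) := by rw [pow_succ]; ring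
        _ ≤ (bridgeCount d n : ℝ) / connectiveConstant d ^ n *
            ((connectiveConstant d ^ N₀)⁻¹ * g (N - n) ^ j) := by
            apply mul_le_mul hgn _ (mul_nonneg (inv_nonneg.2 (pow_nonneg hμ.le _)) (pow_nonneg (hg0 _) _))
              (le_trans (hg0 N) hgn)
            exact mul_le_mul_of_nonneg_left (pow_le_pow_left₀ (hg0 N) hgmono j)
              (inv_nonneg.2 (pow_nonneg hμ.le _))
        _ ≤ (bridgeCount d n : ℝ) / connectiveConstant d ^ n *
            ((bridgeCount d (N - n) : ℝ) / connectiveConstant d ^ (N - n)) :=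
            mul_le_mul_of_nonneg_left hih (div_nonneg (Nat.cast_nonneg _) (pow_nonneg hμ.le _))
        _ ≤ (bridgeCount d N : ℝ) / connectiveConstant d ^ N := by
            have := bridgeRatio_supermul (d := d) n (N - n)
            rwa [Nat.add_sub_cancel' hnN] at this


end Literature.Probability.RandomPlanarGeometry.SAW.Zd

end
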